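/- Copyright: the b2b-balaban cell (near-miss cell 7), T⁴-continuum fan-out; row NE7b CRUX team (2), seat
t4-ne7b-formalise-leaf-03 (gen 28) — custodian's D-50-2′ «THE WEIGHTED PLUG CHAIN», part 1 of the chain: the WEIGHT-GENERIC
siblings of the OWNER's `HistoryBankingForestPlug` §3 and `B16HistoryWeightPlug` §2 (lineage t4-ne7b-p1 gen 44), with the
seven M5-2c volume displays REPLACED by ONE per-live-component PLUG display and the class weight `2^{d+3}` by a letter `w`;
plus the two instances available in the tree (M5-2c `exp_treeVol_le_pedMV`, M5-2d `exp_volume_le_genT_shrunk`).  Released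
under the licence of the surrounding project. -/
import Summits.QuantumFields.BalabanUV.T4Continuum.Support.B16HistoryWeightPlug
import Summits.QuantumFields.BalabanUV.T4Continuum.Support.HistoryBankingShrunkWitness

/-!
# D-50-2′ part 1 — THE WEIGHT OF A TERM IN THE END's CURRENCY, VOLUME LEDGER AS A PLUG: `weight ≤ LIVE(w) · DEAD · rest`
# for ANY class weight `w` under ONE displayed per-component inequality (re-open object (α) of row NE7b; custodian
# lineage `t4-ne7b-formalise-leaf-03` gen 28, on the OWNER's R-OWNER-51-1 (5) commission «D-50-2»)

Summits-side support leaf of the T⁴-continuum cell (rung (B)+1 on a FINITE torus only; NOT infinite volume, NOT the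
mass gap, NOT the Clay statement; NOT a proof of the spine estimate NE7b — the cell's OWN estimate, NOT PRINTED, NOT
PROVED).  [folklore] by-name copies of two existing proofs (`HistoryBankingForestPlug.prod_pow_card_le_live_mul_dead`,
`B16HistoryWeightPlug.weight_le_live_mul_dead`) in which the M5-2c display block `hLu0 hj1 hLu hsmall huΦ huE₂ huE₃` is
REPLACED by the per-live-component PLUG display it was only ever used to prove, and the literal `2 ^ (d + 3)` by a weight
letter `w : ℝ`; plus the instances of the plug the tree already proves.  No `def`, no structure, no `[cite:]` tag,
nothing printed asserted, no `Prop` fact minted, zero `sorry`.  B16 = [Balaban1989LargeFieldII] pp. 380–387 under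
audit; locators only.

WHY (located F-ne7bleaf03g28-1, journal «INTENT 1 D-50-2′»).  M5-2c (`HistoryBankingVolumePlug.exp_volume_le_genT`),
M5-2d (`HistoryBankingShrunkWitness.exp_volume_le_genT_shrunk`) and M5-2e ((E5) `…_shrunk82`) conclude the SAME sentence
`exp (Σ_{m≤K} u_m·compSum id (toPGen cell c) m) ≤ exp (lifeCost (dictWT Prod.fst R C.n₁) (costT Prod.fst C K R) (genT c)) ·
exp (birthWT Prod.fst (w·u) (genT c))` at `w = 2^{d+3}`, `cvol d j Γ`, `cvol82 d j Γ`; the four modules between it and the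
(α) record threaded M5-2c's displays and `2^{d+3}` verbatim, so no later ledger reached the terminal theorem.  THIS FILE
makes the weight a letter and the ledger a plug at the two lowest levels.

WHAT.  §1 **`prod_pow_card_le_live_mul_dead_of_plug`** (pass-V objects): for `Λ ≥ 1`, `u = log ∘ Λ`, ANY `w` and the plug
display `hplug : ∀ c ∈ histV.comp K, exp (treeVol id pedMV u K (K, c)) ≤ exp (lifeCost …) · exp (birthWT Prod.fst (w·u) (genT
(K, c)))`, M2 brick B's volume factor `∏_{j≤K} ∏_{c ∈ histM.comp j} Λ j^{#c.2} ≤ (∏_{c ∈ histV.comp K} exp (lifeCost …) · exp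
(birthWT Prod.fst (w·u) …)) · ∏_{j<K} ∏_{c ∈ histV.died j} exp (treeVol … j (j, c))` (only the process conditions of the
forest lemma remain: `NewOK`, `Rm ≤ R`, its one-step form, `2 ≤ Rm t 1`, `NewDisjoint`, `0 < L`).  §2
**`weight_le_live_mul_dead_of_plug`**: `B16HistoryWeightPlug.weight_le_live_mul_dead` with the same replacement on the run
`J := ℛ.runOf K a (h, ℓ, c)` — the banking side conditions `4 ≤ L`, drop control, `R ≥ 1`, `13 ≤ n₁`, `E₂, E₃ ≥ 0` LEAVE the
statement (they were only the plug's).  §3 THE INSTANCES on the pass-V objects: **`plug_of_flat`** (M5-2c: the seven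
displays ⇒ the plug at `w = 2^{d+3}`; = `exp_treeVol_le_pedMV`), **`plug_of_shrunk`** (M5-2d: `hΓ0 hΓ hj1`, `hsmall :
1122^d·16·21^d·Γ ≤ 2^j∕2`, `huS : u_t·6·1122^d ≤ floorK`, `huE₂ huE₃` ⇒ the plug at `w = cvol d j Γ`; =
`exp_volume_le_genT_shrunk` ∘ ForestPlug §1's three dischargers).  The M5-2e instance `plug_of_shrunk82` is appended when
(E5) `HistoryBankingShrunkWitness82` lands (same three lines).

HONEST SCOPE.  Plumbing over OUR carriers: the weight becomes a letter, the ledger a display; nothing of Bałaban's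
asserted, instantiated or discharged; the OWNER's modules stay the `w = 2^{d+3}` theorems of record, unchanged by name.
NE7b NOT PRINTED ∕ NOT PROVED; spine 0∕9.  HONEST DEPENDENCY (cell): continuum YM on T⁴ ⇐ BetaPertH ∧ nine spine
estimates (0/9 proved); BetaPertH ⇐ (D1) ∧ (D4) ∧ CAP+tail; G-an2-4 gates asym, D1 and NE2/3/4.  This file changes none
of it.
-/

open Finset MeasureTheory
open Literature.MathematicalPhysics.QuantumFieldTheory.Balaban1983to89
open Literature.MathematicalPhysics.QuantumFieldTheory.Balaban1983to89.B13ScaleTransfer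
open Literature.MathematicalPhysics.QuantumFieldTheory.Balaban1983to89.B16SProfile
open T4PersistenceDictionary T4PrintedShapeBanking T4TaggedShapeBanking T4BankedInduction
open Summit.QuantumFields.BalabanUV.T4Continuum.HistoryAdmissible
open Summit.QuantumFields.BalabanUV.T4Continuum.HistoryRealise
open Summit.QuantumFields.BalabanUV.T4Continuum.HistoryRealiseWeak
open Summit.QuantumFields.BalabanUV.T4Continuum.HistoryGen
open Summit.QuantumFields.BalabanUV.T4Continuum.HistoryGenealogyExtraction
open Summit.QuantumFields.BalabanUV.T4Continuum.HistoryGenealogyRealise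
open Summit.QuantumFields.BalabanUV.T4Continuum.HistoryGenealogyInstantiate
open Summit.QuantumFields.BalabanUV.T4Continuum.HistoryGenealogyPedigree
open Summit.QuantumFields.BalabanUV.T4Continuum.B16HistoryIndexedRepr
open Summit.QuantumFields.BalabanUV.T4Continuum.HistoryBankingForestVolume
open Summit.QuantumFields.BalabanUV.T4Continuum.HistoryBankingVolumePlug
open Summit.QuantumFields.BalabanUV.T4Continuum.HistoryBankingForestPlug
open Summit.QuantumFields.BalabanUV.T4Continuum.HistoryBankingShrunkLedger
open Summit.QuantumFields.BalabanUV.T4Continuum.HistoryBankingShrunkWitness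
open Summit.QuantumFields.BalabanUV.T4Continuum.B16HistoryWeightPlug

namespace Summit.QuantumFields.BalabanUV.T4Continuum.B16HistoryWeightPlugW

noncomputable section

-- the structural `DecidableEq` instance of the concrete tag type `Lab (ℕ × Lab d) (Lab d)` exceeds the default
-- synthesis size (as in the two modules this file twins)
set_option synthInstance.maxSize 1024

/-! ## §1 M2 brick B's volume factor along the pass-V forest, the live ledger as a PLUG -/

section PassV

variable {d : ℕ} {I : RunInputM d} {C : T4PrintedShapeBanking.Consts}

/-- **M2 BRICK B's VOLUME FACTOR ≤ LIVE(w) · DEAD, THE LIVE LEDGER DISPLAYED** (`HistoryBankingForestPlug.prod_pow_card_le_live_mul_dead`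
with its seven volume displays replaced by the per-component plug they proved and `2^{d+3}` by `w`): for per-cube level
costs `Λ j ≥ 1` and any weight `w`, if every live component's tree volume factor is booked by its tagged genealogy up to
the `w`-weighted class remainder, then `∏_{j ≤ K} ∏_{c ∈ histM.comp j} Λ j ^ #c.2 ≤ (∏_{c ∈ histV.comp K} exp (lifeCost …
(costT …) (pedMV.genT (K, c))) · exp (birthWT Prod.fst (w·log ∘ Λ) (pedMV.genT (K, c)))) · ∏_{j < K} ∏_{c ∈ histV.died j}
exp (treeVol id pedMV (log ∘ Λ) j (j, c))`. [folklore] -/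
theorem prod_pow_card_le_live_mul_dead_of_plug (hN : I.NewOK) (hRm : ∀ t k, I.Rm t k ≤ I.R t)
    (hRmS : ∀ t k, I.Rm t (k + 1) ≤ I.R (t + 1)) (hRm2 : ∀ t, 2 ≤ I.Rm t 1) (hD : I.NewDisjoint) (hL : 0 < I.L)
    {Λ : ℕ → ℝ} (hΛ : ∀ j, 1 ≤ Λ j) {K : ℕ} (w : ℝ)
    (hplug : ∀ c ∈ I.histV.comp K,
      Real.exp (treeVol I.L I.s (fun v => (v : ℝ)) I.pedMV (fun j => Real.log (Λ j)) K (K, c)) ≤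
        Real.exp (lifeCost (dictWT Prod.fst I.R C.n₁) (costT Prod.fst C K I.R) (I.pedMV.genT (K, c))) *
          Real.exp (birthWT Prod.fst (fun n => w * Real.log (Λ n)) (I.pedMV.genT (K, c)))) :
    ∏ j ∈ Finset.range (K + 1), ∏ c ∈ I.histM.comp j, Λ j ^ (c.2).card ≤
      (∏ c ∈ I.histV.comp K,
          Real.exp (lifeCost (dictWT Prod.fst I.R C.n₁) (costT Prod.fst C K I.R) (I.pedMV.genT (K, c))) *
            Real.exp (birthWT Prod.fst (fun n => w * Real.log (Λ n)) (I.pedMV.genT (K, c)))) *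
        ∏ j ∈ Finset.range K, ∏ c ∈ I.histV.died j,
          Real.exp (treeVol I.L I.s (fun v => (v : ℝ)) I.pedMV (fun j => Real.log (Λ j)) j (j, c)) :=
  (prod_pow_card_le_prod_exp_forest hN hRm hRmS hRm2 hD hL hΛ K).trans
    (mul_le_mul_of_nonneg_right (Finset.prod_le_prod (fun _ _ => (Real.exp_pos _).le) hplug)
      (Finset.prod_nonneg fun _ _ => Finset.prod_nonneg fun _ _ => (Real.exp_pos _).le))

/-! ## §3 (placed here for the pass-V variables) The instances of the plug the tree proves -/

/-- **THE M5-2c INSTANCE** (`w = 2^{d+3}`): the seven lag displays ⇒ the plug — `HistoryBankingForestPlug.exp_treeVol_le_pedMV`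
by name. [folklore] -/
theorem plug_of_flat (hN : I.NewOK) (hRm : ∀ t k, I.Rm t k ≤ I.R t) (hRmS : ∀ t k, I.Rm t (k + 1) ≤ I.R (t + 1))
    (hRm2 : ∀ t, 2 ≤ I.Rm t 1) (hD : I.NewDisjoint) (hL : 0 < I.L) (hL4 : 4 ≤ I.L) (hdrop : ∀ m, DropCtl I.s m)
    (hR : ∀ t, 1 ≤ I.R t) (hn₁ : 13 ≤ C.n₁) (hE₂ : 0 ≤ C.E₂) (hE₃ : 0 ≤ C.E₃) {K : ℕ} {Λ : ℕ → ℝ} (hΛ : ∀ j, 1 ≤ Λ j)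
    {Lu : ℝ} (hLu0 : 0 < Lu) {j : ℕ} (hj1 : 1 ≤ j)
    (hLu : ∀ t i, i ≤ j → Real.log (Λ (t + i)) ≤ Lu * Real.log (Λ t))
    (hsmall : (1122 : ℝ) ^ d * 16 * 21 ^ d * Lu ≤ 2 ^ j / 2)
    (huΦ : ∀ t, t ≤ K → Real.log (Λ t) * (6 * (561 ^ d * j * Lu + 1122 ^ d * Lu)) ≤ floorK C K I.R t)
    (huE₂ : ∀ n, n ≤ K → Real.log (Λ n) * (15 * 126 ^ d) ≤ C.E₂ * (I.R n : ℝ) ^ C.q')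
    (huE₃ : ∀ n, n ≤ K → Real.log (Λ n) * (24 * 126 ^ d) ≤ C.E₃ * (I.R n : ℝ) ^ C.q') :
    ∀ c ∈ I.histV.comp K,
      Real.exp (treeVol I.L I.s (fun v => (v : ℝ)) I.pedMV (fun j => Real.log (Λ j)) K (K, c)) ≤
        Real.exp (lifeCost (dictWT Prod.fst I.R C.n₁) (costT Prod.fst C K I.R) (I.pedMV.genT (K, c))) *
          Real.exp (birthWT Prod.fst (fun n => 2 ^ (d + 3) * Real.log (Λ n)) (I.pedMV.genT (K, c))) :=
  fun _ hc => exp_treeVol_le_pedMV hN hRm hRmS hRm2 hD hL hL4 hdrop hR hn₁ hE₂ hE₃ hc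
    (fun n => Real.log_nonneg (hΛ n)) hLu0 hj1 hLu hsmall huΦ huE₂ huE₃

/-- **THE M5-2d INSTANCE** (`w = cvol d j Γ`): the shrunk-ledger displays (cumulative growth `Γ`, lag `j`, the LAG-FREE
floor `u_t·6·1122^d ≤ floorK`, `E₂`∕`E₃` calibrations) ⇒ the plug — `HistoryBankingShrunkWitness.exp_volume_le_genT_shrunk` on
the pass-V objects through `HistoryBankingForestPlug` §1's three dischargers. [folklore] -/
theorem plug_of_shrunk (hN : I.NewOK) (hRm : ∀ t k, I.Rm t k ≤ I.R t) (hRmS : ∀ t k, I.Rm t (k + 1) ≤ I.R (t + 1))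
    (hRm2 : ∀ t, 2 ≤ I.Rm t 1) (hD : I.NewDisjoint) (hL : 0 < I.L) (hL4 : 4 ≤ I.L) (hdrop : ∀ m, DropCtl I.s m)
    (hR : ∀ t, 1 ≤ I.R t) (hn₁ : 13 ≤ C.n₁) (hE₂ : 0 ≤ C.E₂) (hE₃ : 0 ≤ C.E₃) {K : ℕ} {Λ : ℕ → ℝ} (hΛ : ∀ j, 1 ≤ Λ j)
    {Γ : ℝ} (hΓ0 : 0 ≤ Γ) (hΓ : ∀ t n, t ≤ n → Real.log (Λ n) ≤ Γ * Real.log (Λ t)) {j : ℕ} (hj1 : 1 ≤ j)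
    (hsmall : (1122 : ℝ) ^ d * 16 * 21 ^ d * Γ ≤ 2 ^ j / 2)
    (huS : ∀ t, t ≤ K → Real.log (Λ t) * (6 * 1122 ^ d) ≤ floorK C K I.R t)
    (huE₂ : ∀ n, n ≤ K → Real.log (Λ n) * (15 * 126 ^ d) ≤ C.E₂ * (I.R n : ℝ) ^ C.q')
    (huE₃ : ∀ n, n ≤ K → Real.log (Λ n) * (24 * 126 ^ d) ≤ C.E₃ * (I.R n : ℝ) ^ C.q') :
    ∀ c ∈ I.histV.comp K,
      Real.exp (treeVol I.L I.s (fun v => (v : ℝ)) I.pedMV (fun j => Real.log (Λ j)) K (K, c)) ≤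
        Real.exp (lifeCost (dictWT Prod.fst I.R C.n₁) (costT Prod.fst C K I.R) (I.pedMV.genT (K, c))) *
          Real.exp (birthWT Prod.fst (fun n => cvol d j Γ * Real.log (Λ n)) (I.pedMV.genT (K, c))) :=
  fun c hc => exp_volume_le_genT_shrunk hL4 hdrop hR hn₁ hE₂ hE₃ I.pedMV id RunInputM.renew_step_pedMV (K, c)
    (RunInputM.realisesW_pedMV hN hRm hRmS hRm2 hD hL hc) (wf_genT_pedMV hN hRm hRmS hRm2 hD hL hL4 hdrop hR hn₁ hc)
    (lastStep_toPGen_pedMV_le hN hRm hRmS hRm2 hD hL hc) (lt_reach_genT_pedMV hN hRm hRmS hRm2 hD hL hL4 hdrop hR hn₁ hc)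
    (fun n => Real.log_nonneg (hΛ n)) hΓ0 hΓ hj1 hsmall huS huE₂ huE₃

end PassV

/-! ## §2 The weight of a term: live members in the booked-cost currency at weight `w`, the ledger a plug -/

section Weight

variable {DomK : ℕ → Type*} {I : (K : ℕ) → HIndex (DomK K)} {d : ℕ} {X : ℕ → Type*}
  {𝒢 : (K : ℕ) → GoodClass (X K)}

/-- **THE WEIGHT OF A TERM IN THE END's CURRENCY, ANY CLASS WEIGHT** (`B16HistoryWeightPlug.weight_le_live_mul_dead` with the
volume ledger DISPLAYED as a plug on the run `J := runOf K a (h, ℓ, c)` and `2^{d+3}` replaced by `w`): under `HistRead`, the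
pass-V process conditions of `J` and `hplug : ∀ x ∈ J.histV.comp K, exp (treeVol id J.pedMV (log Λ K) K (K, x)) ≤ exp
(lifeCost (dictWT Prod.fst J.R C.n₁) (costT Prod.fst C K J.R) (J.pedMV.genT (K, x))) · exp (birthWT Prod.fst (w·log Λ K) (J.pedMV.genT (K,
x)))`, for `K₀ ≤ K`, `|t| ≤ l₀`, `(h, ℓ, c) ∈ LIdx a`: `weight μ Rp t ⟨K, a, (h, ℓ, c)⟩ ≤ LIVE(w) · DEAD · rest` — literally the
owner's conclusion with `2 ^ (d + 3) ↦ w`. [folklore] -/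
theorem weight_le_live_mul_dead_of_plug [∀ K, MeasurableSpace (X K)] (ℛ : HistReading I d) (Φf : HistFactors I d)
    (μ : (K : ℕ) → Measure (X K)) [∀ K, IsFiniteMeasure (μ K)] (Rp : (K : ℕ) → ℝ → Repr172R (𝒢 K) (I K))
    {l₀ : ℝ} {K₀ : ℕ} (hR : HistRead ℛ Φf Rp l₀ K₀) {K : ℕ} (hK : K₀ ≤ K) {t : ℝ} (ht : |t| ≤ l₀)
    (a : (I K).Adm) {h : (I K).HZ} {l : (I K).HL} {c : (I K).HC} (hι : (h, l, c) ∈ (I K).LIdx a)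
    (hN : (ℛ.runOf K a (h, l, c)).NewOK)
    (hRm : ∀ t k, (ℛ.runOf K a (h, l, c)).Rm t k ≤ (ℛ.runOf K a (h, l, c)).R t)
    (hRmS : ∀ t k, (ℛ.runOf K a (h, l, c)).Rm t (k + 1) ≤ (ℛ.runOf K a (h, l, c)).R (t + 1))
    (hRm2 : ∀ t, 2 ≤ (ℛ.runOf K a (h, l, c)).Rm t 1) (hD : (ℛ.runOf K a (h, l, c)).NewDisjoint)
    (hL0 : 0 < (ℛ.runOf K a (h, l, c)).L) {C : T4PrintedShapeBanking.Consts} (w : ℝ)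
    (hplug : ∀ x ∈ (ℛ.runOf K a (h, l, c)).histV.comp K,
      Real.exp (treeVol (ℛ.runOf K a (h, l, c)).L (ℛ.runOf K a (h, l, c)).s (fun v => (v : ℝ))
          (ℛ.runOf K a (h, l, c)).pedMV (fun j => Real.log (Φf.Λ K j)) K (K, x)) ≤
        Real.exp (lifeCost (dictWT Prod.fst (ℛ.runOf K a (h, l, c)).R C.n₁)
            (costT Prod.fst C K (ℛ.runOf K a (h, l, c)).R) ((ℛ.runOf K a (h, l, c)).pedMV.genT (K, x))) *
          Real.exp (birthWT Prod.fst (fun n => w * Real.log (Φf.Λ K n)) ((ℛ.runOf K a (h, l, c)).pedMV.genT (K, x)))) :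
    Repr172R.weight μ Rp t ⟨K, a, (h, l, c)⟩ ≤
      (∏ x ∈ (ℛ.runOf K a (h, l, c)).histV.comp K,
          Real.exp (lifeCost (dictWT Prod.fst (ℛ.runOf K a (h, l, c)).R C.n₁)
              (costT Prod.fst C K (ℛ.runOf K a (h, l, c)).R) ((ℛ.runOf K a (h, l, c)).pedMV.genT (K, x))) *
            Real.exp (birthWT Prod.fst (fun n => w * Real.log (Φf.Λ K n))
              ((ℛ.runOf K a (h, l, c)).pedMV.genT (K, x))) *
            evProd (Φf.fB K) (Φf.fR K) ((ℛ.runOf K a (h, l, c)).pedMV.toPGen id (K, x))) *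
        (∏ j ∈ Finset.range K, ∏ x ∈ (ℛ.runOf K a (h, l, c)).histV.died j,
          Real.exp (treeVol (ℛ.runOf K a (h, l, c)).L (ℛ.runOf K a (h, l, c)).s (fun v => (v : ℝ))
              (ℛ.runOf K a (h, l, c)).pedMV (fun j => Real.log (Φf.Λ K j)) j (j, x)) *
            evProd (Φf.fB K) (Φf.fR K) ((ℛ.runOf K a (h, l, c)).pedMV.toPGen id (j, x))) *
        (Real.exp (Φf.BA K t) * (Φf.wC K t a c * Real.exp (Φf.BV K t a h l c)) * (μ K).real Set.univ) := by
  set J := ℛ.runOf K a (h, l, c) with hJ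
  have hmem : h ∈ (I K).HZs a ∧ l ∈ (I K).HYs a ∧ c ∈ (I K).HCs a := by
    simpa [HIndex.LIdx, Finset.mem_product] using hι
  have hF := hR.forest_le K t ht hK a (h, l, c) hι
  -- U1 per elementary term (M1) with the displayed envelopes, then the identification (as in M2 brick B)
  have hBx : ∀ x, |(Rp K t).eterm a (h, l, c) x| ≤
      (∏ j ∈ Finset.range (K + 1), ∏ c' ∈ J.histM.comp j, Φf.levelFactor J.histM J.rnwM K j c') *
        (Real.exp (Φf.BA K t) * (Φf.wC K t a c * Real.exp (Φf.BV K t a h l c))) := by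
    intro x
    have hwC : 0 ≤ Φf.wC K t a c := (((Rp K t).TC a c).one_nonneg x).trans (hR.tc_le K t ht hK a c hmem.2.2 x)
    have hE : 0 ≤ Real.exp (Φf.BA K t) * (Φf.wC K t a c * Real.exp (Φf.BV K t a h l c)) :=
      mul_nonneg (Real.exp_pos _).le (mul_nonneg hwC (Real.exp_pos _).le)
    calc |(Rp K t).eterm a (h, l, c) x|
        ≤ Φf.wZ K t a h * (Real.exp (Φf.BA K t) * (Φf.wY K t a l * (Φf.wC K t a c * Real.exp (Φf.BV K t a h l c)))) :=
          (Rp K t).abs_eterm_le a (h, l, c) (fun V => hR.χ01 K t a V) (fun W => hR.tz_le K t ht hK a h hmem.1 W)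
            (fun W => hR.ty_le K t ht hK a l hmem.2.1 W) (fun W => hR.tc_le K t ht hK a c hmem.2.2 W)
            (hR.A'_le K t ht hK) (fun W => hR.Vs_le K t ht hK a h l c W) x
      _ = Φf.wZ K t a h * Φf.wY K t a l *
            (Real.exp (Φf.BA K t) * (Φf.wC K t a c * Real.exp (Φf.BV K t a h l c))) := by ring
      _ ≤ _ := mul_le_mul_of_nonneg_right hF hE
  -- U1 integrated (M2-A): `|weight| ≤ (∏ levelFactor) · E · mass`, hence the right-hand side is NONNEGATIVE
  have hw := Repr172R.abs_weight_le μ Rp t K a (h, l, c) hBx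
  have hP := Φf.prod_levelFactor_eq_pedM J hN hRm K
  -- abbreviations
  set VOLM := ∏ j ∈ Finset.range (K + 1), ∏ c' ∈ J.histM.comp j, Φf.Λ K j ^ (c'.2).card with hVOLM
  set EVM := (∏ c' ∈ J.histM.comp K, evProd (Φf.fB K) (Φf.fR K) (J.pedM.toPGen id (K, c'))) *
    ∏ j ∈ Finset.range K, ∏ c' ∈ J.histM.died j, evProd (Φf.fB K) (Φf.fR K) (J.pedM.toPGen id (j, c')) with hEVM
  set E := Real.exp (Φf.BA K t) * (Φf.wC K t a c * Real.exp (Φf.BV K t a h l c)) * (μ K).real Set.univ with hE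
  have hVpos : 0 < VOLM :=
    Finset.prod_pos fun j _ => Finset.prod_pos fun c' _ => lt_of_lt_of_le zero_lt_one (Φf.one_le_Λ_pow K j _)
  -- `weight ≤ VOLM · EVM · E` and `0 ≤ VOLM · EVM · E`
  have h1 : Repr172R.weight μ Rp t ⟨K, a, (h, l, c)⟩ ≤ VOLM * EVM * E := by
    have := (le_abs_self _).trans hw
    rw [hP] at this
    calc _ ≤ _ := this
      _ = _ := by rw [hE]; ring
  have h0 : 0 ≤ VOLM * EVM * E := by
    have := (abs_nonneg _).trans hw
    rw [hP] at this
    calc (0 : ℝ) ≤ _ := this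
      _ = _ := by rw [hE]; ring
  have hEE : 0 ≤ EVM * E := by
    have h' : 0 ≤ VOLM * (EVM * E) := by rw [← mul_assoc]; exact h0
    exact (mul_nonneg_iff_of_pos_left hVpos).1 h'
  -- the volume factor along the pass-V forest AT WEIGHT `w` (§1, the ledger a plug); the event products moved to `pedMV`
  have hV := prod_pow_card_le_live_mul_dead_of_plug (I := J) (C := C) hN hRm hRmS hRm2 hD hL0
    (Λ := Φf.Λ K) (fun j => Φf.one_le_Λ K j) w hplug
  have hlive := prod_comp_evProd_pedMV hN hRm hRmS hRm2 hD hL0 (Φf.fB K) (Φf.fR K) K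
  have hdead : ∏ j ∈ Finset.range K, ∏ x ∈ J.histV.died j, evProd (Φf.fB K) (Φf.fR K) (J.pedMV.toPGen id (j, x)) =
      ∏ j ∈ Finset.range K, ∏ x ∈ J.histM.died j, evProd (Φf.fB K) (Φf.fR K) (J.pedM.toPGen id (j, x)) :=
    Finset.prod_congr rfl fun j _ => prod_died_evProd_pedMV hN hRm hRmS hRm2 hD hL0 (Φf.fB K) (Φf.fR K) j
  have h2 : VOLM * EVM * E ≤
      ((∏ x ∈ J.histV.comp K,
          Real.exp (lifeCost (dictWT Prod.fst J.R C.n₁) (costT Prod.fst C K J.R) (J.pedMV.genT (K, x))) *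
            Real.exp (birthWT Prod.fst (fun n => w * Real.log (Φf.Λ K n)) (J.pedMV.genT (K, x)))) *
        ∏ j ∈ Finset.range K, ∏ x ∈ J.histV.died j,
          Real.exp (treeVol J.L J.s (fun v => (v : ℝ)) J.pedMV (fun j => Real.log (Φf.Λ K j)) j (j, x))) *
        EVM * E := by
    rw [mul_assoc, mul_assoc _ EVM E]
    exact mul_le_mul_of_nonneg_right hV hEE
  have eq1 : (∏ x ∈ J.histV.comp K,
      Real.exp (lifeCost (dictWT Prod.fst J.R C.n₁) (costT Prod.fst C K J.R) (J.pedMV.genT (K, x))) *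
        Real.exp (birthWT Prod.fst (fun n => w * Real.log (Φf.Λ K n)) (J.pedMV.genT (K, x))) *
        evProd (Φf.fB K) (Φf.fR K) (J.pedMV.toPGen id (K, x))) =
      (∏ x ∈ J.histV.comp K,
        Real.exp (lifeCost (dictWT Prod.fst J.R C.n₁) (costT Prod.fst C K J.R) (J.pedMV.genT (K, x))) *
          Real.exp (birthWT Prod.fst (fun n => w * Real.log (Φf.Λ K n)) (J.pedMV.genT (K, x)))) *
        ∏ x ∈ J.histV.comp K, evProd (Φf.fB K) (Φf.fR K) (J.pedMV.toPGen id (K, x)) :=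
    Finset.prod_mul_distrib
  have eq2 : (∏ j ∈ Finset.range K, ∏ x ∈ J.histV.died j,
      Real.exp (treeVol J.L J.s (fun v => (v : ℝ)) J.pedMV (fun j => Real.log (Φf.Λ K j)) j (j, x)) *
        evProd (Φf.fB K) (Φf.fR K) (J.pedMV.toPGen id (j, x))) =
      (∏ j ∈ Finset.range K, ∏ x ∈ J.histV.died j,
        Real.exp (treeVol J.L J.s (fun v => (v : ℝ)) J.pedMV (fun j => Real.log (Φf.Λ K j)) j (j, x))) *
        ∏ j ∈ Finset.range K, ∏ x ∈ J.histV.died j, evProd (Φf.fB K) (Φf.fR K) (J.pedMV.toPGen id (j, x)) := by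
    rw [← Finset.prod_mul_distrib]
    exact Finset.prod_congr rfl fun j _ => Finset.prod_mul_distrib
  refine h1.trans (h2.trans (le_of_eq ?_))
  rw [eq1, eq2, hEVM, ← hlive, ← hdead]
  ring

/-- **THE OWNER's THEOREM OF RECORD IS THE `w = 2^{d+3}` INSTANCE** (consistency, by the elaborator; an `example`, so that
no landed statement is re-declared): the term `weight_le_live_mul_dead_of_plug … (2 ^ (d + 3)) (plug_of_flat …)` is accepted
AT THE TYPE of `B16HistoryWeightPlug.weight_le_live_mul_dead`, read off by `type_of%`. [folklore] -/
example [∀ K, MeasurableSpace (X K)] (ℛ : HistReading I d) (Φf : HistFactors I d)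
    (μ : (K : ℕ) → Measure (X K)) [∀ K, IsFiniteMeasure (μ K)] (Rp : (K : ℕ) → ℝ → Repr172R (𝒢 K) (I K))
    {l₀ : ℝ} {K₀ : ℕ} (hR : HistRead ℛ Φf Rp l₀ K₀) {K : ℕ} (hK : K₀ ≤ K) {t : ℝ} (ht : |t| ≤ l₀)
    (a : (I K).Adm) {h : (I K).HZ} {l : (I K).HL} {c : (I K).HC} (hι : (h, l, c) ∈ (I K).LIdx a)
    (hN : (ℛ.runOf K a (h, l, c)).NewOK)
    (hRm : ∀ t k, (ℛ.runOf K a (h, l, c)).Rm t k ≤ (ℛ.runOf K a (h, l, c)).R t)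
    (hRmS : ∀ t k, (ℛ.runOf K a (h, l, c)).Rm t (k + 1) ≤ (ℛ.runOf K a (h, l, c)).R (t + 1))
    (hRm2 : ∀ t, 2 ≤ (ℛ.runOf K a (h, l, c)).Rm t 1) (hD : (ℛ.runOf K a (h, l, c)).NewDisjoint)
    (hL0 : 0 < (ℛ.runOf K a (h, l, c)).L) (hL4 : 4 ≤ (ℛ.runOf K a (h, l, c)).L)
    (hdrop : ∀ m, DropCtl (ℛ.runOf K a (h, l, c)).s m) (hR1 : ∀ t, 1 ≤ (ℛ.runOf K a (h, l, c)).R t)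
    {C : T4PrintedShapeBanking.Consts} (hn₁ : 13 ≤ C.n₁) (hE₂ : 0 ≤ C.E₂) (hE₃ : 0 ≤ C.E₃) {Lu : ℝ} (hLu0 : 0 < Lu)
    {j : ℕ} (hj1 : 1 ≤ j) (hLu : ∀ t i, i ≤ j → Real.log (Φf.Λ K (t + i)) ≤ Lu * Real.log (Φf.Λ K t))
    (hsmall : (1122 : ℝ) ^ d * 16 * 21 ^ d * Lu ≤ 2 ^ j / 2)
    (huΦ : ∀ t, t ≤ K →
      Real.log (Φf.Λ K t) * (6 * (561 ^ d * j * Lu + 1122 ^ d * Lu)) ≤ floorK C K (ℛ.runOf K a (h, l, c)).R t)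
    (huE₂ : ∀ n, n ≤ K → Real.log (Φf.Λ K n) * (15 * 126 ^ d) ≤ C.E₂ * ((ℛ.runOf K a (h, l, c)).R n : ℝ) ^ C.q')
    (huE₃ : ∀ n, n ≤ K → Real.log (Φf.Λ K n) * (24 * 126 ^ d) ≤ C.E₃ * ((ℛ.runOf K a (h, l, c)).R n : ℝ) ^ C.q') :
    type_of% (weight_le_live_mul_dead ℛ Φf μ Rp hR hK ht a hι hN hRm hRmS hRm2 hD hL0 hL4 hdrop hR1 hn₁ hE₂ hE₃ hLu0 hj1
      hLu hsmall huΦ huE₂ huE₃) :=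
  weight_le_live_mul_dead_of_plug ℛ Φf μ Rp hR hK ht a hι hN hRm hRmS hRm2 hD hL0 (C := C) (2 ^ (d + 3))
    (plug_of_flat hN hRm hRmS hRm2 hD hL0 hL4 hdrop hR1 hn₁ hE₂ hE₃ (fun j => Φf.one_le_Λ K j) hLu0 hj1 hLu hsmall huΦ
      huE₂ huE₃)

end Weight

end

end Summit.QuantumFields.BalabanUV.T4Continuum.B16HistoryWeightPlugW
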